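import Summits.ValiantsHypothesis.ValiantsHypothesis.Theorems.BarrierLeverSuccinctHittingSetsForVPUniversalSize

/-!
# Crux `BarrierLever.SuccinctHittingSetsForVP` (stmt-ValiantsHypothesis-14610) — Raz's universal
# circuit-graph is ONE small circuit JOINTLY in the inputs and the labels (FSV Lemma 13's ingredient)

`…UniversalSize.lean` bounds the size of every specialisation `OUT(y) = RazUniversal.outVal y`. Here
the SAME bound `2B + r (rN)(4B + 1)`, `B = #σ + rN`, is proved for the single polynomial
`OUT ∈ ℂ[z ⊕ Y]` — the flattening `jointOut = (sumAlgEquiv ℂ σ Lab).symm RazUniversal.out` of the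
generic output, labels read as variables (`complexity_jointOut_le`; `aeval_labels_jointOut`:
`Y ↦ y` gives back `OUT(y)`). This is the jointness of the universal generator asked for by the cell
planner `valiant-natproofs-p1` (WANTED W1 `UniversalJointness`; Forbes–Shpilka–Volk 2018, Lemma 13),
the property that the planted design generators provably lack under permanent hardness
(`AlgebraicNaturalProofsPlanting.lean`). Proof: the level-by-level substitution of
`…UniversalSize.complexity_outVal_le` verbatim with label variables in place of constant weights.
Unconditional; does NOT close the item.

References: [Raz2010] Prop. 2.8, §3.2; [ForbesShpilkaVolk2018] Lemma 13; [Burgisser2000] Rem. 2.7.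
-/

-- layout Summits/ValiantsHypothesis/ValiantsHypothesis forces the duplicated namespace component
set_option linter.dupNamespace false

noncomputable section

namespace Summit.ValiantsHypothesis.ValiantsHypothesis.Theorems.BarrierLever.SuccinctHittingSetsForVP

open Literature.Computability.AlgebraicComplexity MvPolynomial RazUniversal

namespace UniversalJointSize

variable {σ : Type*} [Fintype σ] {r N : ℕ}

/-! ### Small pieces: sums of products of two symbols -/

/-- A sum of `#ι` products of two symbols costs `≤ 2 #ι` gates. [cite: Burgisser2000, §2.1] -/
theorem complexity_varWeightedSum_le {Z : Type*} {ι : Type*} [Fintype ι] (l z : ι → Z) :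
    complexity (∑ i, (X (l i) : MvPolynomial Z ℂ) * X (z i)) ≤ 2 * Fintype.card ι := by
  refine (complexity_finset_sum_le _ _).trans ?_
  have h1 : ∀ i, complexity ((X (l i) : MvPolynomial Z ℂ) * X (z i)) ≤ 1 := fun i =>
    (complexity_mul_le_holds _ _).trans (by rw [complexity_X_holds, complexity_X_holds])
  calc ∑ i, complexity ((X (l i) : MvPolynomial Z ℂ) * X (z i)) + (Finset.univ : Finset ι).card
      ≤ ∑ _i : ι, 1 + (Finset.univ : Finset ι).card := by gcongr with i; exact h1 i
    _ = 2 * Fintype.card ι := by simp [two_mul]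

/-- Its variables are among the symbols used. [folklore] -/
theorem vars_varWeightedSum_subset {Z : Type*} [DecidableEq Z] {ι : Type*} [Fintype ι]
    (l z : ι → Z) :
    (∑ i, (X (l i) : MvPolynomial Z ℂ) * X (z i)).vars ⊆
      Finset.univ.image l ∪ Finset.univ.image z := by
  intro v hv
  have h := vars_sum_subset (t := Finset.univ)
    (φ := fun i => (X (l i) : MvPolynomial Z ℂ) * X (z i)) hv
  simp only [Finset.mem_biUnion, Finset.mem_univ, true_and] at h
  obtain ⟨i, hi⟩ := h
  have h2 := vars_mul _ _ hi
  rw [vars_X, vars_X, Finset.mem_union, Finset.mem_singleton, Finset.mem_singleton] at h2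
  rcases h2 with rfl | rfl
  · exact Finset.mem_union_left _ (Finset.mem_image.mpr ⟨i, Finset.mem_univ _, rfl⟩)
  · exact Finset.mem_union_right _ (Finset.mem_image.mpr ⟨i, Finset.mem_univ _, rfl⟩)

/-- Evaluating a sum of products of symbols. [folklore] -/
theorem aeval_varWeightedSum {Z : Type*} {ι : Type*} [Fintype ι] {A : Type*} [CommSemiring A]
    [Algebra ℂ A] (V : Z → A) (l z : ι → Z) :
    aeval V (∑ i, (X (l i) : MvPolynomial Z ℂ) * X (z i)) = ∑ i, V (l i) * V (z i) := by
  simp [map_sum]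

/-! ### The flattened universal circuit-graph -/

/-- The node polynomial of the universal circuit-graph with the labels read as variables:
`J_{d,b} ∈ ℂ[z ⊕ Y]`, the flattening of `RazUniversal.base d b`. [cite: Raz2010, Prop. 2.8 (p. 154)] -/
def jointBase (d : Fin (r + 1)) (b : BIdx σ r N) : MvPolynomial (σ ⊕ Lab σ r N) ℂ :=
  (sumAlgEquiv ℂ σ (Lab σ r N)).symm (base d b)

variable (σ r N) in
/-- The output of the universal circuit-graph with the labels read as variables:
`OUT ∈ ℂ[z ⊕ Y]`, the flattening of `RazUniversal.out`. [cite: Raz2010, Prop. 2.8 (p. 154)] -/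
def jointOut : MvPolynomial (σ ⊕ Lab σ r N) ℂ :=
  (sumAlgEquiv ℂ σ (Lab σ r N)).symm (out ℂ σ r N)

/-- A leaf computes `z_t` at level `1` and nothing elsewhere. [cite: Raz2010, Prop. 2.8 (p. 154)] -/
theorem jointBase_inl (d : Fin (r + 1)) (t : σ) :
    jointBase d (Sum.inl t : BIdx σ r N) = if (d : ℕ) = 1 then X (Sum.inl t) else 0 := by
  unfold jointBase
  rw [base]
  split_ifs
  · simp [sumAlgEquiv_symm_X]
  · exact map_zero _

/-- A product slot multiplies two label-weighted sums of the lower nodes.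
[cite: Raz2010, Prop. 2.8 (pp. 154–155)] -/
theorem jointBase_inr (d : Fin (r + 1)) (j : Fin r) (k : Fin N)
    (h : 1 ≤ (j : ℕ) ∧ (j : ℕ) < (d : ℕ)) :
    jointBase d (Sum.inr (j, k) : BIdx σ r N) =
      (∑ b : BIdx σ r N, X (Sum.inr (Sum.inl (d, j, k, false, b))) * jointBase (Fin.castSucc j) b) *
        (∑ b : BIdx σ r N, X (Sum.inr (Sum.inl (d, j, k, true, b))) *
          jointBase ⟨(d : ℕ) - j, by have := d.isLt; omega⟩ b) := by
  unfold jointBase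
  rw [base, dif_pos h, map_mul, map_sum, map_sum]
  simp only [map_mul, sumAlgEquiv_symm_C_X]

/-- A void product slot computes `0`. [cite: Raz2010, Prop. 2.8 (pp. 154–155)] -/
theorem jointBase_inr_of_not (d : Fin (r + 1)) (j : Fin r) (k : Fin N)
    (h : ¬ (1 ≤ (j : ℕ) ∧ (j : ℕ) < (d : ℕ))) : jointBase d (Sum.inr (j, k) : BIdx σ r N) = 0 := by
  unfold jointBase
  rw [base, dif_neg h, map_zero]

/-- The output gate is the label-weighted sum of the level-`r` nodes.
[cite: Raz2010, Prop. 2.8 (p. 154)] -/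
theorem jointOut_eq :
    jointOut σ r N = ∑ b : BIdx σ r N, X (Sum.inr (Sum.inr b)) * jointBase (Fin.last r) b := by
  unfold jointOut out jointBase
  rw [map_sum]
  simp only [map_mul, sumAlgEquiv_symm_C_X]

omit [Fintype σ] in
/-- Specialising the label variables to `y` recovers `OUT(y)`: for every
`P ∈ (ℂ[Y])[z]`, substituting `z ↦ z`, `Y ↦ y` in its flattening is `map (eval y) P`.
[cite: Raz2010, §3.2 (p. 157)] -/
theorem aeval_labels_symm_sumAlgEquiv (y : Lab σ r N → ℂ)
    (P : MvPolynomial σ (MvPolynomial (Lab σ r N) ℂ)) :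
    aeval (Sum.elim X fun l => C (y l)) ((sumAlgEquiv ℂ σ (Lab σ r N)).symm P) =
      MvPolynomial.map (eval y) P := by
  set F : MvPolynomial σ (MvPolynomial (Lab σ r N) ℂ) →+* MvPolynomial σ ℂ :=
    (aeval (Sum.elim X fun l => C (y l)) :
        MvPolynomial (σ ⊕ Lab σ r N) ℂ →ₐ[ℂ] MvPolynomial σ ℂ).toRingHom.comp
      ((sumAlgEquiv ℂ σ (Lab σ r N)).symm :
        MvPolynomial σ (MvPolynomial (Lab σ r N) ℂ) →ₐ[ℂ] MvPolynomial (σ ⊕ Lab σ r N) ℂ).toRingHom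
    with hF
  have key : F = MvPolynomial.map (eval y) := by
    refine MvPolynomial.ringHom_ext (fun a => ?_) (fun t => ?_)
    · -- constants `a ∈ ℂ[Y]`: both sides restrict to the ring hom `a ↦ C (a(y))`
      have hc : F.comp (C : MvPolynomial (Lab σ r N) ℂ →+* MvPolynomial σ (MvPolynomial (Lab σ r N) ℂ)) =
          (C : ℂ →+* MvPolynomial σ ℂ).comp (eval y) := by
        refine MvPolynomial.ringHom_ext (fun c => ?_) (fun l => ?_)
        · show aeval (Sum.elim X fun l => C (y l)) ((sumAlgEquiv ℂ σ (Lab σ r N)).symm (C (C c))) =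
            C (eval y (C c))
          rw [sumAlgEquiv_symm_C_C, eval_C, aeval_C, algebraMap_eq]
        · show aeval (Sum.elim X fun l => C (y l)) ((sumAlgEquiv ℂ σ (Lab σ r N)).symm (C (X l))) =
            C (eval y (X l))
          rw [sumAlgEquiv_symm_C_X, eval_X, aeval_X, Sum.elim_inr]
      have := RingHom.congr_fun hc a
      show _ = MvPolynomial.map (eval y) (C a)
      rw [map_C]
      exact this
    · show aeval (Sum.elim X fun l => C (y l)) ((sumAlgEquiv ℂ σ (Lab σ r N)).symm (X t)) =
        MvPolynomial.map (eval y) (X t)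
      rw [sumAlgEquiv_symm_X, aeval_X, Sum.elim_inl, map_X]
  show F P = _
  rw [key]

/-- `OUT` with the labels specialised to `y` is `OUT(y)`. [cite: Raz2010, §3.2 (p. 157)] -/
theorem aeval_labels_jointOut (y : Lab σ r N → ℂ) :
    aeval (Sum.elim X fun l => C (y l)) (jointOut σ r N) = outVal y :=
  aeval_labels_symm_sumAlgEquiv y _

/-! ### The size of the joint output -/

/-- **The universal circuit-graph is ONE small circuit in inputs and labels**:
`L(OUT) ≤ 2B + r · (rN) · (4B + 1)`, `B = #σ + rN`, for the flattened generic output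
`OUT ∈ ℂ[z ⊕ Y]` (same bound as for each specialisation `OUT(y)`, `…UniversalSize.complexity_outVal_le`;
same level-by-level substitution, label variables in place of constant weights).
[cite: Raz2010, Prop. 2.8 (pp. 154–155); ForbesShpilkaVolk2018, Lemma 13] -/
theorem complexity_jointOut_le :
    complexity (jointOut σ r N) ≤ 2 * (Fintype.card σ + r * N) +
      r * ((r * N) * (4 * (Fintype.card σ + r * N) + 1)) := by
  classical
  -- the degenerate graph `r = 0` outputs `0`
  rcases Nat.eq_zero_or_pos r with hr0 | hr1
  · subst hr0
    have h0 : jointOut σ 0 N = 0 := by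
      rw [jointOut_eq]
      refine Finset.sum_eq_zero fun b _ => ?_
      rcases b with t | ⟨j, _⟩
      · rw [jointBase_inl]; simp
      · exact j.elim0
    rw [h0, ← C_0, complexity_C_holds]
    exact Nat.zero_le _
  set B := Fintype.card σ + r * N with hB
  have hcardB : Fintype.card (BIdx σ r N) = B := by
    simp [BIdx, Fintype.card_sum, Fintype.card_prod, Fintype.card_fin, hB]
  set K := (r * N) * (4 * B + 1) with hK
  let Zt := (σ ⊕ Lab σ r N) ⊕ (Fin (r + 1) × BIdx σ r N)
  let V : Zt → MvPolynomial (σ ⊕ Lab σ r N) ℂ := Sum.elim X fun p => jointBase p.1 p.2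
  let E : Fin (r + 1) → BIdx σ r N → MvPolynomial Zt ℂ := fun d =>
    Sum.elim (fun t => if (d : ℕ) = 1 then X (Sum.inl (Sum.inl t)) else 0) fun jk =>
      if h : 1 ≤ (jk.1 : ℕ) ∧ (jk.1 : ℕ) < (d : ℕ) then
        (∑ b, (X (Sum.inl (Sum.inr (Sum.inl (d, jk.1, jk.2, false, b)))) : MvPolynomial Zt ℂ) *
            X (Sum.inr (Fin.castSucc jk.1, b))) *
          (∑ b, (X (Sum.inl (Sum.inr (Sum.inl (d, jk.1, jk.2, true, b)))) : MvPolynomial Zt ℂ) *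
            X (Sum.inr (⟨(d : ℕ) - jk.1, by have := d.isLt; omega⟩, b)))
      else 0
  let φ : Fin (r + 1) → Zt → MvPolynomial Zt ℂ := fun d =>
    Sum.elim (fun t => X (Sum.inl t)) fun p => if p.1 = d then E d p.2 else X (Sum.inr p)
  -- (F1) the defining expressions evaluate to the node polynomials
  have hE : ∀ d b, aeval V (E d b) = jointBase d b := by
    intro d b
    rcases b with t | ⟨j, k⟩
    · simp only [E, Sum.elim_inl]
      rw [jointBase_inl]
      split_ifs <;> simp [V]
    · simp only [E, Sum.elim_inr]
      by_cases h : 1 ≤ (j : ℕ) ∧ (j : ℕ) < (d : ℕ)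
      · rw [dif_pos h, map_mul, aeval_varWeightedSum, aeval_varWeightedSum, jointBase_inr d j k h]
        rfl
      · rw [dif_neg h, map_zero, jointBase_inr_of_not d j k h]
  -- (F2) hence `φ d` does not change the semantics
  have hφ : ∀ d z, aeval V (φ d z) = V z := by
    intro d z
    rcases z with t | p
    · simp [φ, V]
    · simp only [φ, Sum.elim_inr]
      split_ifs with hp
      · rw [hE]; simp [V, hp]
      · simp [V]
  have hφ' : ∀ d (T : MvPolynomial Zt ℂ), aeval V (aeval (φ d) T) = aeval V T := by
    intro d T
    rw [← AlgHom.comp_apply, comp_aeval]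
    have : (fun i => aeval V (φ d i)) = V := funext (hφ d)
    rw [this]
  -- (F3) cost of one level of substitutions
  have hcostE : ∀ d b, complexity (E d b) ≤ 4 * B + 1 := by
    intro d b
    rcases b with t | ⟨j, k⟩
    · simp only [E, Sum.elim_inl]
      split_ifs
      · rw [complexity_X_holds]; omega
      · rw [← C_0, complexity_C_holds]; omega
    · simp only [E, Sum.elim_inr]
      split_ifs
      · refine (complexity_mul_le_holds _ _).trans ?_
        have h1 := complexity_varWeightedSum_le (Z := Zt)
          (fun b => Sum.inl (Sum.inr (Sum.inl (d, j, k, false, b))))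
          (fun b => Sum.inr (Fin.castSucc j, b))
        have h2 := complexity_varWeightedSum_le (Z := Zt)
          (fun b => Sum.inl (Sum.inr (Sum.inl (d, j, k, true, b))))
          (fun b => Sum.inr (⟨(d : ℕ) - j, by have := d.isLt; omega⟩, b))
        rw [hcardB] at h1 h2
        omega
      · rw [← C_0, complexity_C_holds]; omega
  have hcostφ : ∀ d, ∑ z, complexity (φ d z) ≤ K := by
    intro d
    rw [hK, Fintype.sum_sum_type]
    have h0 : ∑ t : σ ⊕ Lab σ r N, complexity (φ d (Sum.inl t)) = 0 :=
      Finset.sum_eq_zero fun t _ => by simp only [φ, Sum.elim_inl]; exact complexity_X_holds _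
    rw [h0, zero_add, Fintype.sum_prod_type]
    rw [Finset.sum_eq_single d]
    · simp only [φ, Sum.elim_inr, if_true]
      rw [Fintype.sum_sum_type]
      have hl : ∑ t : σ, complexity (E d (Sum.inl t)) = 0 := Finset.sum_eq_zero fun t _ => by
        simp only [E, Sum.elim_inl]
        split_ifs
        · exact complexity_X_holds _
        · simpa using complexity_C_holds (σ := Zt) (0 : ℂ)
      rw [hl, zero_add]
      calc ∑ jk : Fin r × Fin N, complexity (E d (Sum.inr jk))
          ≤ ∑ _jk : Fin r × Fin N, (4 * B + 1) := Finset.sum_le_sum fun jk _ => hcostE d _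
        _ = (r * N) * (4 * B + 1) := by simp [Fintype.card_prod, Fintype.card_fin]
    · intro d' _ hne
      exact Finset.sum_eq_zero fun b _ => by
        simp only [φ, Sum.elim_inr, if_neg hne]; exact complexity_X_holds _
    · intro h; exact absurd (Finset.mem_univ d) h
  -- (F4) the variables after expanding level `d`
  let inS : ℕ → Zt → Prop := fun m => Sum.elim (fun _ => True) fun p => 1 ≤ (p.1 : ℕ) ∧ (p.1 : ℕ) ≤ m
  have hvarsE : ∀ (d : Fin (r + 1)) b, ∀ v ∈ (E d b).vars, inS ((d : ℕ) - 1) v := by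
    intro d b v hv
    rcases b with t | ⟨j, k⟩
    · simp only [E, Sum.elim_inl] at hv
      split_ifs at hv
      · rw [vars_X, Finset.mem_singleton] at hv; subst hv; trivial
      · simp at hv
    · simp only [E, Sum.elim_inr] at hv
      split_ifs at hv with h
      · rcases Finset.mem_union.mp (vars_mul _ _ hv) with h1 | h1
        · rcases Finset.mem_union.mp (vars_varWeightedSum_subset _ _ h1) with h3 | h3
          · obtain ⟨b, -, rfl⟩ := Finset.mem_image.mp h3
            trivial
          · obtain ⟨b, -, rfl⟩ := Finset.mem_image.mp h3
            simp only [inS, Sum.elim_inr, Fin.val_castSucc]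
            omega
        · rcases Finset.mem_union.mp (vars_varWeightedSum_subset _ _ h1) with h3 | h3
          · obtain ⟨b, -, rfl⟩ := Finset.mem_image.mp h3
            trivial
          · obtain ⟨b, -, rfl⟩ := Finset.mem_image.mp h3
            simp only [inS, Sum.elim_inr]
            omega
      · simp at hv
  have hvarsφ : ∀ (d : Fin (r + 1)) (T : MvPolynomial Zt ℂ), 1 ≤ (d : ℕ) →
      (∀ v ∈ T.vars, inS d v) → ∀ v ∈ (aeval (φ d) T).vars, inS ((d : ℕ) - 1) v := by
    intro d T hd hT v hv
    rw [aeval_eq_bind₁] at hv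
    obtain ⟨z, hz, hvz⟩ := Finset.mem_biUnion.mp (vars_bind₁ _ _ hv)
    have hzS := hT z hz
    rcases z with t | ⟨d', b⟩
    · simp only [φ, Sum.elim_inl] at hvz
      rw [vars_X, Finset.mem_singleton] at hvz; subst hvz; trivial
    · simp only [φ, Sum.elim_inr] at hvz
      split_ifs at hvz with hp
      · subst hp; exact hvarsE _ _ v hvz
      · rw [vars_X, Finset.mem_singleton] at hvz
        subst hvz
        simp only [inS, Sum.elim_inr] at hzS ⊢
        have : (d' : ℕ) ≠ (d : ℕ) := fun h => hp (Fin.ext h)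
        omega
  -- (F5) the top: output gate as a label-weighted sum of level-`r` symbols
  let top : MvPolynomial Zt ℂ :=
    ∑ b, (X (Sum.inl (Sum.inr (Sum.inr b))) : MvPolynomial Zt ℂ) * X (Sum.inr (Fin.last r, b))
  have htopV : aeval V top = jointOut σ r N := by
    simp only [top]
    rw [aeval_varWeightedSum, jointOut_eq]
    simp [V]
  have htopC : complexity top ≤ 2 * B := by
    have := complexity_varWeightedSum_le (Z := Zt) (fun b => Sum.inl (Sum.inr (Sum.inr b)))
      (fun b => Sum.inr (Fin.last r, b))
    rwa [hcardB] at this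
  have htopS : ∀ v ∈ top.vars, inS r v := by
    intro v hv
    rcases Finset.mem_union.mp (vars_varWeightedSum_subset _ _ hv) with h3 | h3
    · obtain ⟨b, -, rfl⟩ := Finset.mem_image.mp h3
      trivial
    · obtain ⟨b, -, rfl⟩ := Finset.mem_image.mp h3
      simp only [inS, Sum.elim_inr, Fin.val_last]
      omega
  -- (F6) expand the levels `r, r-1, …, 1`
  let U : ℕ → MvPolynomial Zt ℂ := fun i =>
    Nat.rec top (fun i acc => aeval (φ ⟨r - i, by omega⟩) acc) i
  have hU0 : U 0 = top := rfl
  have hUs : ∀ i, U (i + 1) = aeval (φ ⟨r - i, by omega⟩) (U i) := fun i => rfl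
  have hUV : ∀ i, aeval V (U i) = jointOut σ r N := by
    intro i
    induction i with
    | zero => rw [hU0, htopV]
    | succ i ih => rw [hUs, hφ', ih]
  have hUC : ∀ i, complexity (U i) ≤ 2 * B + i * K := by
    intro i
    induction i with
    | zero => rw [hU0]; simpa using htopC
    | succ i ih =>
      rw [hUs, add_mul, one_mul]
      refine (complexity_aeval_le _ _).trans ?_
      have := hcostφ ⟨r - i, by omega⟩
      omega
  have hUvars : ∀ i, i ≤ r → ∀ v ∈ (U i).vars, inS (r - i) v := by
    intro i
    induction i with
    | zero => intro _ v hv; rw [hU0] at hv; simpa using htopS v hv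
    | succ i ih =>
      intro hi v hv
      rw [hUs] at hv
      have h := hvarsφ ⟨r - i, by omega⟩ (U i) (by simp; omega) (ih (by omega)) v hv
      simp only at h
      rwa [show r - i - 1 = r - (i + 1) by omega] at h
  -- (F7) after `r` steps only input symbols remain: `U r = rename inl q`, and `q = OUT`
  have hvars : ↑(U r).vars ⊆ Set.range (Sum.inl : σ ⊕ Lab σ r N → Zt) := by
    intro v hv
    have h := hUvars r le_rfl v hv
    rcases v with t | p
    · exact ⟨t, rfl⟩
    · simp only [inS, Sum.elim_inr, Nat.sub_self] at h; omega
  obtain ⟨q, hq⟩ := exists_rename_eq_of_vars_subset_range (U r) Sum.inl Sum.inl_injective hvars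
  have hqout : q = jointOut σ r N := by
    have h1 := hUV r
    rw [← hq, aeval_rename] at h1
    have h2 : (V ∘ Sum.inl : σ ⊕ Lab σ r N → MvPolynomial (σ ⊕ Lab σ r N) ℂ) = X := by
      funext t; simp [V]
    rw [h2, aeval_X_left] at h1
    simpa using h1
  calc complexity (jointOut σ r N) = complexity q := by rw [hqout]
    _ = complexity (rename (Sum.inl : σ ⊕ Lab σ r N → Zt) q) :=
        (complexity_rename_of_injective_holds Sum.inl_injective q).symm
    _ = complexity (U r) := by rw [hq]
    _ ≤ 2 * B + r * K := hUC r

/-- Polynomial form for `σ = Fin n`: `L(OUT) ≤ 7 (n + r + N + 1)^5`, as for each `OUT(y)`.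
[cite: Raz2010, Prop. 2.8] -/
theorem complexity_jointOut_le_poly {n : ℕ} :
    complexity (jointOut (Fin n) r N) ≤ 7 * (n + r + N + 1) ^ 5 := by
  refine (complexity_jointOut_le (σ := Fin n) (r := r) (N := N)).trans ?_
  rw [Fintype.card_fin]
  set T := n + r + N + 1 with hT
  have hn : n ≤ T := by omega
  have hr : r ≤ T := by omega
  have hN : N ≤ T := by omega
  have h1 : 1 ≤ T := by omega
  have hB : n + r * N ≤ T ^ 2 := by nlinarith
  have h12 : 1 ≤ T ^ 2 := Nat.one_le_pow _ _ h1
  have h25 : T ^ 2 ≤ T ^ 5 := Nat.pow_le_pow_right h1 (by norm_num)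
  calc 2 * (n + r * N) + r * (r * N * (4 * (n + r * N) + 1))
      ≤ 2 * T ^ 2 + T * (T * T * (4 * T ^ 2 + T ^ 2)) := by gcongr
    _ = 2 * T ^ 2 + 5 * T ^ 5 := by ring
    _ ≤ 7 * T ^ 5 := by omega

end UniversalJointSize

end Summit.ValiantsHypothesis.ValiantsHypothesis.Theorems.BarrierLever.SuccinctHittingSetsForVP

end
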